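import Summits.CriticalPhenomena.CardyFormulaZ2.Theorems.CardyUniqueLimitCardyRigiditySlitCardyCutFlow
import Literature.Probability.Process.PathSpaceTightness
import HarnessLib

/-!
# Cut-1 of STUB A3b, flow side (II): `f(η)` just after the level time

Crux `Summit.CriticalPhenomena.CardyFormulaZ2.Theses.CardyUniqueLimit.CardyRigidity`
(stmt-CriticalPhenomena-0746), line `crossing_martingale`, stub A3b `stub_slitObservableApprox`,
cut "freezing at the level step" (Camia–Newman 2007, §5), continuation of
`…SlitCardyCutFlow.lean`:

* `SlitCardyCut.exists_modulus_eta` — uniform continuity of `ĝ ∘ η` on a level box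
  `[m', M'] × [d', G] × [d', G]` (`η = cardyEta a (a+g₁) (a+g₁+g₂)`, continuous `ĝ`);
* `SlitCardyCut.abs_sub_apply_etaProc_lt` — for a kernel `f` agreeing with `ĝ` on the moduli of
  the relaxed level box: on the window `[ρ, ρ + Δ]` after the level time `ρ` (marks moving by
  `≤ μ₀`, `2μ₀ <` the modulus of `ĝ ∘ η`), the clock is before the relaxed level time and
  `|f(η_t) - f(η_ρ)| < κ₁`;
* `SlitCardyCut.exists_window`, `abs_sub_le_of_modulusSet` — bookkeeping: the tolerance `μ₀`,
  the driver level `j'` and the window `Δ` serving the cut, and the oscillation of a box driver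
  (`Process.modulusSet`) on a short window.
-/

noncomputable section

open MeasureTheory Filter Set Topology Metric
open scoped NNReal ENNReal
open Literature.Probability Literature.Probability.RandomPlanarGeometry

namespace Summit.CriticalPhenomena.CardyFormulaZ2.Cruxes.CardyRigidity.CrossingMartingale

namespace SlitCardyCut

section Eta

variable {x : Fin 3 → ℝ} {m M d : ℝ} {Ω : Type*} {W : Ω → ℝ≥0 → ℝ} {ω : Ω}

/-- **Uniform continuity of `ĝ ∘ η` on a level box**: for continuous `ĝ` and a box
`[m', M'] × [d', G] × [d', G]` with `m', d' > 0` (so that the denominators of `cardyEta` do not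
vanish), `(a, g₁, g₂) ↦ ĝ (cardyEta a (a+g₁) (a+g₁+g₂))` is uniformly continuous on the box.
[folklore] -/
theorem exists_modulus_eta {ĝ : ℝ → ℝ} (hĝc : Continuous ĝ) {m' M' d' G : ℝ} (hm' : 0 < m')
    (hd' : 0 < d') {κ₁ : ℝ} (hκ₁ : 0 < κ₁) :
    ∃ μ > 0, ∀ p ∈ Icc m' M' ×ˢ Icc d' G ×ˢ Icc d' G, ∀ q ∈ Icc m' M' ×ˢ Icc d' G ×ˢ Icc d' G,
      dist p q < μ → |ĝ (cardyEta p.1 (p.1 + p.2.1) (p.1 + p.2.1 + p.2.2)) -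
        ĝ (cardyEta q.1 (q.1 + q.2.1) (q.1 + q.2.1 + q.2.2))| < κ₁ := by
  set box : Set (ℝ × ℝ × ℝ) := Icc m' M' ×ˢ Icc d' G ×ˢ Icc d' G with hboxdef
  set Ψ : ℝ × ℝ × ℝ → ℝ := fun p ↦ ĝ (cardyEta p.1 (p.1 + p.2.1) (p.1 + p.2.1 + p.2.2)) with hΨ
  have hpos : ∀ p ∈ box, 0 < p.1 ∧ 0 < p.2.1 ∧ 0 < p.2.2 := by
    rintro p ⟨hp0, hp1, hp2⟩
    exact ⟨hm'.trans_le hp0.1, hd'.trans_le hp1.1, hd'.trans_le hp2.1⟩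
  have hΦc : ContinuousOn (fun p : ℝ × ℝ × ℝ ↦ cardyEta p.1 (p.1 + p.2.1) (p.1 + p.2.1 + p.2.2)) box := by
    intro p hp
    obtain ⟨h1, h2, h3⟩ := hpos p hp
    refine ContinuousAt.continuousWithinAt ?_
    have hden : (p.1 + p.2.1) * (p.1 + p.2.1 + p.2.2 - p.1) ≠ 0 := by
      have hA : 0 < p.1 + p.2.1 := by linarith
      have hB : 0 < p.1 + p.2.1 + p.2.2 - p.1 := by linarith
      exact (mul_pos hA hB).ne'
    simp only [cardyEta]
    refine ContinuousAt.div ?_ ?_ hden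
    · exact continuousAt_fst.mul
        ((continuousAt_fst.add (continuousAt_fst.comp continuousAt_snd)).add
          (continuousAt_snd.comp continuousAt_snd) |>.sub
          (continuousAt_fst.add (continuousAt_fst.comp continuousAt_snd)))
    · exact (continuousAt_fst.add (continuousAt_fst.comp continuousAt_snd)).mul
        (((continuousAt_fst.add (continuousAt_fst.comp continuousAt_snd)).add
          (continuousAt_snd.comp continuousAt_snd)).sub continuousAt_fst)
  have hΨc : ContinuousOn Ψ box := hĝc.comp_continuousOn hΦc
  have hcpt : IsCompact box := isCompact_Icc.prod (isCompact_Icc.prod isCompact_Icc)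
  obtain ⟨μ, hμ, H⟩ := Metric.uniformContinuousOn_iff.1 (hcpt.uniformContinuousOn_of_continuous hΨc)
    κ₁ hκ₁
  refine ⟨μ, hμ, fun p hp q hq hpq ↦ ?_⟩
  have := H p hp q hq hpq
  rwa [Real.dist_eq] at this

/-- The modulus `η` in level-box coordinates `(a, g₁, g₂) = (X⁰, X¹ - X⁰, X² - X¹)`. [folklore] -/
theorem etaProc_eq_cardyEta_box (t : ℝ≥0) :
    etaProc W x t ω = cardyEta (markFlow W (x 0) t ω)
      (markFlow W (x 0) t ω + (markFlow W (x 1) t ω - markFlow W (x 0) t ω))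
      (markFlow W (x 0) t ω + (markFlow W (x 1) t ω - markFlow W (x 0) t ω) +
        (markFlow W (x 2) t ω - markFlow W (x 1) t ω)) := by
  simp only [etaProc]
  congr 1 <;> ring

/-- **`f(η)` moves little on the window after the level time.**  Let `f` agree with a
continuous `ĝ` on an interval containing the moduli of the relaxed level box, `ĝ ∘ η` have
modulus `(μ, κ₁)` there, and the marks move by `≤ μ₀` on `[ρ, ρ + Δ]` (`marks_window`) with
`2μ₀ < μ`.  Then every `t` in the window is before the relaxed level time and
`|f(η_t) - f(η_ρ)| < κ₁`. [cite: CamiaNewman2007, §5] -/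
theorem abs_sub_apply_etaProc_lt {f ĝ : ℝ → ℝ} {k₁ k₂ : ℝ} (hĝf : EqOn ĝ f (Icc k₁ k₂))
    (hbox : ∀ a g₁ g₂ : ℝ, a ∈ Icc (m / 2) (M + 1) → g₁ ∈ Icc (d / 2) (x 2 - x 0 + 1) →
      g₂ ∈ Icc (d / 2) (x 2 - x 0 + 1) → cardyEta a (a + g₁) (a + g₁ + g₂) ∈ Icc k₁ k₂)
    {κ₁ μ : ℝ}
    (hΨ : ∀ p ∈ Icc (m / 2) (M + 1) ×ˢ Icc (d / 2) (x 2 - x 0 + 1) ×ˢ Icc (d / 2) (x 2 - x 0 + 1),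
      ∀ q ∈ Icc (m / 2) (M + 1) ×ˢ Icc (d / 2) (x 2 - x 0 + 1) ×ˢ Icc (d / 2) (x 2 - x 0 + 1),
      dist p q < μ → |ĝ (cardyEta p.1 (p.1 + p.2.1) (p.1 + p.2.1 + p.2.2)) -
        ĝ (cardyEta q.1 (q.1 + q.2.1) (q.1 + q.2.1 + q.2.2))| < κ₁)
    (hc : Continuous (W ω)) (hW0 : W ω 0 = 0) (h : AdmissibleLevels x m M d) {ρ Δ : ℝ≥0}
    (hρ : levelTime W x m M d ω = ρ) {κ μ₀ : ℝ} (hμm : μ₀ ≤ m / 4) (hμd : μ₀ ≤ d / 8)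
    (hμ1 : μ₀ < 1) (hμ0 : 2 * μ₀ < μ) (hκμ : κ + 4 * Δ / m ≤ μ₀)
    (hosc : ∀ t : ℝ≥0, ρ ≤ t → t ≤ ρ + Δ → |W ω t - W ω ρ| ≤ κ) {t : ℝ≥0} (hρt : ρ ≤ t)
    (htΔ : t ≤ ρ + Δ) :
    (t : WithTop ℝ≥0) < levelTime W x (m / 2) (M + 1) (d / 2) ω ∧
      |f (etaProc W x t ω) - f (etaProc W x ρ ω)| < κ₁ := by
  have hlt := coe_lt_levelTime_relax hc hW0 h hρ hμm hμd hμ1 hκμ hosc htΔ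
  refine ⟨hlt, ?_⟩
  have hw : W ω 0 ∈ Ioo (x 0 - M) (x 0 - m) := by
    rw [hW0]; exact ⟨by linarith [h.pos, h.lt_M], by linarith [h.m_lt]⟩
  have hw' : W ω 0 ∈ Ioo (x 0 - (M + 1)) (x 0 - m / 2) := by
    rw [hW0]; exact ⟨by linarith [h.pos, h.lt_M], by linarith [h.m_lt, h.m_pos]⟩
  obtain ⟨hX0, hg1, hg2⟩ := MartingaleOfData.marks_mem_box_pt hc h hw hρ.symm.le
  obtain ⟨hX0', hg1', hg2'⟩ := MartingaleOfData.marks_mem_box_pt hc h.relax hw' hlt.le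
  set a := markFlow W (x 0) ρ ω with ha
  set g₁ := markFlow W (x 1) ρ ω - markFlow W (x 0) ρ ω with hg₁
  set g₂ := markFlow W (x 2) ρ ω - markFlow W (x 1) ρ ω with hg₂
  set a' := markFlow W (x 0) t ω with ha'
  set g₁' := markFlow W (x 1) t ω - markFlow W (x 0) t ω with hg₁'
  set g₂' := markFlow W (x 2) t ω - markFlow W (x 1) t ω with hg₂'
  have haI : a ∈ Icc (m / 2) (M + 1) := ⟨by linarith [hX0.1, h.m_pos], by linarith [hX0.2]⟩
  have hg1I : g₁ ∈ Icc (d / 2) (x 2 - x 0 + 1) := ⟨by linarith [hg1.1, h.d_pos], hg1.2⟩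
  have hg2I : g₂ ∈ Icc (d / 2) (x 2 - x 0 + 1) := ⟨by linarith [hg2.1, h.d_pos], hg2.2⟩
  have hq : (a, g₁, g₂) ∈ Icc (m / 2) (M + 1) ×ˢ Icc (d / 2) (x 2 - x 0 + 1) ×ˢ
      Icc (d / 2) (x 2 - x 0 + 1) := ⟨haI, hg1I, hg2I⟩
  have hp : (a', g₁', g₂') ∈ Icc (m / 2) (M + 1) ×ˢ Icc (d / 2) (x 2 - x 0 + 1) ×ˢ
      Icc (d / 2) (x 2 - x 0 + 1) := ⟨hX0', hg1', hg2'⟩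
  -- the two triples are `2μ₀`-close
  have hwin := fun i ↦ marks_window hc hW0 h hρ.symm.le hμm hκμ hosc hρt htΔ i
  have e0 := abs_le.1 (hwin 0).2
  have e1 := abs_le.1 (hwin 1).2
  have e2 := abs_le.1 (hwin 2).2
  have hdist : dist (a', g₁', g₂') (a, g₁, g₂) < μ := by
    rw [Prod.dist_eq, Prod.dist_eq, Real.dist_eq, Real.dist_eq, Real.dist_eq]
    refine max_lt (lt_of_le_of_lt (abs_le.2 ⟨?_, ?_⟩) (by linarith : μ₀ < μ))
      (max_lt (lt_of_le_of_lt (abs_le.2 ⟨?_, ?_⟩) hμ0) (lt_of_le_of_lt (abs_le.2 ⟨?_, ?_⟩) hμ0))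
    · linarith [e0.1]
    · linarith [e0.2]
    · show -(2 * μ₀) ≤ g₁' - g₁
      rw [hg₁', hg₁]; linarith [e0.2, e1.1]
    · show g₁' - g₁ ≤ 2 * μ₀
      rw [hg₁', hg₁]; linarith [e0.1, e1.2]
    · show -(2 * μ₀) ≤ g₂' - g₂
      rw [hg₂', hg₂]; linarith [e1.2, e2.1]
    · show g₂' - g₂ ≤ 2 * μ₀
      rw [hg₂', hg₂]; linarith [e1.1, e2.2]
  have key := hΨ _ hp _ hq hdist
  rw [etaProc_eq_cardyEta_box (W := W) (x := x) (ω := ω) t,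
    etaProc_eq_cardyEta_box (W := W) (x := x) (ω := ω) ρ,
    ← hĝf (hbox a' g₁' g₂' hX0' hg1' hg2'), ← hĝf (hbox a g₁ g₂ haI hg1I hg2I)]
  exact key

/-! ### Bookkeeping: the window parameters and the oscillation of a box driver -/

/-- **Choice of the window parameters.**  Given the modulus `μ` of `ĝ ∘ η`, the levels `m, d`,
the horizon `t'` and positive driver moduli `δW`, there are a tolerance `μ₀`, a driver level
`j'` with oscillation bound `κ = 1/(j'+1)`, and a window `Δ > 0` with `μ₀ ≤ m/4`, `μ₀ ≤ d/8`,
`μ₀ < 1`, `2μ₀ < μ`, `κ + 4Δ/m ≤ μ₀`, `Δ ≤ δW j'`, `Δ ≤ 1/2`, `t' + 1 ≤ j' + 1`. [folklore] -/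
theorem exists_window {μ m d : ℝ} (hμ : 0 < μ) (hm : 0 < m) (hd : 0 < d) (t' : ℝ≥0)
    {δW : ℕ → ℝ} (hδW : ∀ j, 0 < δW j) :
    ∃ (μ₀ κ : ℝ) (j' : ℕ) (Δ : ℝ≥0), 0 < Δ ∧ μ₀ ≤ m / 4 ∧ μ₀ ≤ d / 8 ∧ μ₀ < 1 ∧ 2 * μ₀ < μ ∧
      κ = 1 / ((j' : ℝ) + 1) ∧ κ + 4 * Δ / m ≤ μ₀ ∧ (Δ : ℝ) ≤ δW j' ∧ (Δ : ℝ) ≤ 1 / 2 ∧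
      (t' : ℝ) + 1 ≤ (j' : ℝ) + 1 := by
  set μ₀ : ℝ := min (μ / 4) (min (m / 4) (min (d / 8) (1 / 2))) with hμ₀
  have hμ₀pos : 0 < μ₀ := lt_min (by positivity)
    (lt_min (by linarith) (lt_min (by linarith) (by norm_num)))
  have hμ₀μ : 2 * μ₀ < μ := by
    have : μ₀ ≤ μ / 4 := min_le_left _ _
    linarith
  have hμ₀m : μ₀ ≤ m / 4 := (min_le_right _ _).trans (min_le_left _ _)
  have hμ₀d : μ₀ ≤ d / 8 := (min_le_right _ _).trans ((min_le_right _ _).trans (min_le_left _ _))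
  have hμ₀1 : μ₀ < 1 := by
    have : μ₀ ≤ 1 / 2 := (min_le_right _ _).trans ((min_le_right _ _).trans (min_le_right _ _))
    linarith
  obtain ⟨j₁, hj₁⟩ := exists_nat_one_div_lt (half_pos hμ₀pos)
  set j' : ℕ := max j₁ (⌈(t' : ℝ)⌉₊ + 1) with hj'
  have hκ : 1 / ((j' : ℝ) + 1) < μ₀ / 2 := by
    refine lt_of_le_of_lt (one_div_le_one_div_of_le (by positivity) ?_) hj₁
    have : (j₁ : ℝ) ≤ j' := by exact_mod_cast le_max_left _ _
    linarith
  have hj't : (t' : ℝ) + 1 ≤ (j' : ℝ) + 1 := by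
    have h1 : (⌈(t' : ℝ)⌉₊ + 1 : ℕ) ≤ j' := le_max_right _ _
    have h2 : ((⌈(t' : ℝ)⌉₊ + 1 : ℕ) : ℝ) ≤ j' := by exact_mod_cast h1
    push_cast at h2
    linarith [Nat.le_ceil (t' : ℝ)]
  set Δr : ℝ := min (δW j') (min (μ₀ * m / 8) (1 / 2)) with hΔr
  have hΔrpos : 0 < Δr := lt_min (hδW j') (lt_min (by positivity) (by norm_num))
  refine ⟨μ₀, 1 / ((j' : ℝ) + 1), j', ⟨Δr, hΔrpos.le⟩, hΔrpos, hμ₀m, hμ₀d, hμ₀1, hμ₀μ, rfl, ?_,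
    min_le_left _ _, (min_le_right _ _).trans (min_le_right _ _), hj't⟩
  have hΔμ : Δr ≤ μ₀ * m / 8 := (min_le_right _ _).trans (min_le_left _ _)
  have h4 : 4 * Δr / m ≤ μ₀ / 2 := by
    rw [div_le_iff₀ hm]; linarith
  show 1 / ((j' : ℝ) + 1) + 4 * Δr / m ≤ μ₀
  linarith

/-- **Oscillation of a box driver on a short window**: a path of `Process.modulusSet {0} δW`
oscillates by at most `1/(j'+1)` on a window `[ρ, ρ + Δ] ⊆ [0, j'+1]` of length `Δ ≤ δW j'`
(stated for the sign-reversed path). [cite: KemppainenSmirnov2017, §3.5] -/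
theorem abs_sub_le_of_modulusSet {W₀ : C(ℝ≥0, ℝ)} {δW : ℕ → ℝ}
    (hW₀ : W₀ ∈ Literature.Probability.Process.modulusSet ({0} : Set ℝ) δW) {j' : ℕ} {ρ Δ : ℝ≥0}
    (hρΔ : (ρ : ℝ) + Δ ≤ j' + 1) (hΔ : (Δ : ℝ) ≤ δW j') {t : ℝ≥0} (hρt : ρ ≤ t)
    (htΔ : t ≤ ρ + Δ) : |(-W₀ t) - (-W₀ ρ)| ≤ 1 / ((j' : ℝ) + 1) := by
  rw [show -W₀ t - -W₀ ρ = W₀ ρ - W₀ t by ring, ← Real.dist_eq]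
  have h1 : ((t : ℝ≥0) : ℝ) ≤ ρ + Δ := by exact_mod_cast htΔ
  have h0 : ((ρ : ℝ≥0) : ℝ) ≤ t := by exact_mod_cast hρt
  refine hW₀.2 j' ρ t (by linarith [Δ.coe_nonneg]) (by linarith) ?_
  rw [NNReal.dist_eq, abs_sub_comm, abs_of_nonneg (by linarith)]
  linarith

end Eta

end SlitCardyCut

/-- **Anchor of this file** (cut-1 of STUB A3b, flow side II): uniform continuity of `ĝ ∘ η`
on a level box, fully explicit form of `SlitCardyCut.exists_modulus_eta`. [folklore] -/
theorem slitCardyCut_exists_modulus_eta : ∀ {ĝ : ℝ → ℝ}, Continuous ĝ → ∀ {m' M' d' G : ℝ}, 0 < m' → 0 < d' → ∀ {κ₁ : ℝ}, 0 < κ₁ → ∃ μ > 0, ∀ p ∈ Set.Icc m' M' ×ˢ Set.Icc d' G ×ˢ Set.Icc d' G, ∀ q ∈ Set.Icc m' M' ×ˢ Set.Icc d' G ×ˢ Set.Icc d' G, dist p q < μ → |ĝ (Literature.Probability.RandomPlanarGeometry.cardyEta p.1 (p.1 + p.2.1) (p.1 + p.2.1 + p.2.2)) - ĝ (Literature.Probability.RandomPlanarGeometry.cardyEta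 q.1 (q.1 + q.2.1) (q.1 + q.2.1 + q.2.2))| < κ₁ :=
  fun hĝc _ _ _ _ hm' hd' _ hκ₁ ↦ SlitCardyCut.exists_modulus_eta hĝc hm' hd' hκ₁

end Summit.CriticalPhenomena.CardyFormulaZ2.Cruxes.CardyRigidity.CrossingMartingale

end
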